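import Literature.AlgebraicGeometry.Morphisms.CechModuleH2
import Literature.AlgebraicGeometry.Morphisms.CechModuleRefinement
import HarnessLib

/-!
# The double complex of two families of opens, in degree `2`: transfer of the vanishing of `Ȟ²`

For a scheme `f : X → Spec A`, a sheaf of `𝒪_X`-modules `M` and two families of opens
`𝒰 = (U_i)_{i ∈ ι}`, `𝒱 = (V_j)_{j ∈ ι'}` covering each other's members (`U_i ⊆ ⋃_j V_j`,
`V_j ⊆ ⋃_i U_i`), consider the double complex `C^{p,q} = Π Γ(U_{i_0…i_p} ∩ V_{j_0…j_q}, M)` of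
the two families (Serre's "double complexe défini par deux recouvrements").  Its `p`-th row is
the Čech complex of `M` on `(U_{i_0…i_p} ∩ V_j)_j` covering `U_{i_0…i_p}`, its `q`-th column that of
`(U_i ∩ V_{j_0…j_q})_i` covering `V_{j_0…j_q}`; both are exact at the augmentation and in degree
`0` by the sheaf axioms.  If moreover

* `Ȟ²((U_i ∩ V_j)_j, M) = 0` for every `i` (row `0` exact in degree `2`),
* `Ȟ¹((U_i ∩ U_{i'} ∩ V_j)_j, M) = 0` for all `i, i'` (row `1` exact in degree `1`),
* `Ȟ¹((U_i ∩ V_j)_i, M) = 0` for every `j` (column `0` exact in degree `1`),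

then the standard zig-zag transports a `2`-cocycle `z` of `𝒱` to a `2`-cocycle `y` of `𝒰`
(`z ↦ x^{0,1} ↦ x^{1,0} ↦ y`, `d_v x^{0,1} = z|`, `d_v x^{1,0} = d_h x^{0,1}`, `y| = d_h x^{1,0}`),
and if `y = d w` is a coboundary the way back (`x^{1,0} - w| = d_h u`, `x^{0,1} - d_v u = t|`,
`z = d t`) shows that `z` is a coboundary:

* `cechMZ2_le_cechMB2_of_two_covers` — **if every `2`-cocycle of `M` on `𝒰` is a `2`-coboundary,
  then so is every `2`-cocycle on `𝒱`;**
* `cechMZ2.cocycle_res` — the `2`-cocycle identity restricted to an open inside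
  `U_i ∩ U_j ∩ U_k ∩ U_l`; `exists_res_eq_of_cechMD0_eq_zero`, `eq_of_forall_res_eq` — `Ȟ⁰ = Γ` on a
  covered open (Görtz–Wedhorn II Lemma 21.65), the two sheaf-axiom inputs of the zig-zag.

This file deliberately imports only `CechModuleH2` and `CechModuleRefinement` (restriction of
cochains along `U_I ∩ V_j ⊆ V_j` is the refinement map `cechMRefineC0/C1` with `τ = id`; the few
facts about it needed here are proved privately).

No affineness appears here; the three vanishing hypotheses are supplied, for affine-localizing
`M`, by the affine vanishing theorems or by the contractibility of families containing their union
(`CechModuleAffine`, `CechModuleH2CoverIndependence`).  This is the degree-`2` Čech-internal core of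
"Čech cohomology of a quasi-coherent sheaf may be computed on any affine open cover" (Hartshorne
III Thm. 4.5; Görtz–Wedhorn II Thm. 22.9).  Everything is proved; no named facts; no definitions.
Mathlib searched (pin v4.32): no Čech cohomology of sheaves of modules on schemes.

## References

* U. Görtz, T. Wedhorn, *Algebraic Geometry II: Cohomology of Schemes*, Springer Spektrum (2023),
  doi:10.1007/978-3-658-43031-3: Lemma 21.65 (`Ȟ⁰ = Γ` for sheaves), p. 260; Thm. 22.9, p. 332.
  [GortzWedhorn2023]
* R. Hartshorne, *Algebraic Geometry*, GTM 52 (1977): III Lemma 4.4, Thm. 4.5 (p. 222).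
  [Hartshorne1977]
* J.-P. Serre, *Faisceaux algébriques cohérents*, Ann. of Math. 61 (1955), n°29 — classical source
  of the two-coverings double complex (not held in the corpus; not consulted).
* The Stacks Project, Tag 01ED. [StacksProject]
-/

noncomputable section

open CategoryTheory AlgebraicGeometry Limits TopologicalSpace Opposite

universe u v w

namespace Literature.AlgebraicGeometry.Morphisms

variable {A : Type u} [CommRing A] {X : Scheme.{u}} (f : X ⟶ Spec (.of A)) (M : X.Modules)

/-! ## Restricting the `2`-cocycle identity -/

section Cocycle

variable {ι : Type v} (U : ι → X.Opens)

/-- The cocycle identity `e_{jkl} - e_{ikl} + e_{ijl} - e_{ijk} = 0` of a Čech `2`-cocycle of `M`,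
restricted to any open `W ⊆ U_i ∩ U_j ∩ U_k ∩ U_l`.
[cite: StacksProject, Tag 01ED (Cohomology, Section 20.9)] -/
theorem cechMZ2.cocycle_res {e : CechMC2 f M U} (he : e ∈ cechMZ2 f M U) (i j k l : ι)
    {W : X.Opens} (hi : W ≤ U i) (hj : W ≤ U j) (hk : W ≤ U k) (hl : W ≤ U l) :
    MSections.res f M (le_inf (le_inf hj hk) hl) (e j k l) -
        MSections.res f M (le_inf (le_inf hi hk) hl) (e i k l) +
          MSections.res f M (le_inf (le_inf hi hj) hl) (e i j l) -
            MSections.res f M (le_inf (le_inf hi hj) hk) (e i j k) = 0 := by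
  have h0 : cechMD2 f M U e i j k l = 0 := by
    rw [(mem_cechMZ2_iff f M U e).mp he]; rfl
  have h1 := congrArg
    (MSections.res f M (le_inf (le_inf (le_inf hi hj) hk) hl : W ≤ U i ⊓ U j ⊓ U k ⊓ U l)) h0
  rw [cechMD2_apply, map_sub, map_add, map_sub, map_zero, MSections.res_res, MSections.res_res,
    MSections.res_res, MSections.res_res] at h1
  exact h1

end Cocycle

/-! ## Restriction of cochains along a map of families (private plumbing) -/

section Refine

variable {ι : Type v} {ι' : Type w} (U : ι → X.Opens) (V : ι' → X.Opens) (τ : ι' → ι)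
  (hτ : ∀ j, V j ≤ U (τ j))

/-- `d¹` commutes with refinement, componentwise. [folklore] -/
private theorem cechMD1_refineC1_apply (c : CechMC1 f M U) (j j' j'' : ι') :
    cechMD1 f M V (cechMRefineC1 f M U V τ hτ c) j j' j'' =
      MSections.res f M (inf_le_inf (inf_le_inf (hτ j) (hτ j')) (hτ j''))
        (cechMD1 f M U c (τ j) (τ j') (τ j'')) := by
  simp only [cechMD1_apply, cechMRefineC1_apply, map_sub, map_add, MSections.res_res]

/-- Refining twice is refining once (on `1`-cochains). [folklore] -/
private theorem refineC1_refineC1 {ι'' : Type*} (W : ι'' → X.Opens) (σ : ι'' → ι')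
    (hσ : ∀ k, W k ≤ V (σ k)) (c : CechMC1 f M U) :
    cechMRefineC1 f M V W σ hσ (cechMRefineC1 f M U V τ hτ c) =
      cechMRefineC1 f M U W (τ ∘ σ) (fun k => (hσ k).trans (hτ (σ k))) c := by
  funext k k'
  simp only [cechMRefineC1_apply, MSections.res_res]
  rfl

/-- Proof-irrelevance of the inclusions in `cechMRefineC1`. [folklore] -/
private theorem refineC1_irrel (hτ' : ∀ j, V j ≤ U (τ j)) (c : CechMC1 f M U) :
    cechMRefineC1 f M U V τ hτ c = cechMRefineC1 f M U V τ hτ' c := rfl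

/-- The restriction `(z_{τj τj' τj''}|)` of a `2`-cocycle along a map of families is a `2`-cocycle.
[folklore] -/
private theorem refine₂_mem_cechMZ2 {z : CechMC2 f M U} (hz : z ∈ cechMZ2 f M U) :
    (fun j j' j'' => MSections.res f M (inf_le_inf (inf_le_inf (hτ j) (hτ j')) (hτ j''))
      (z (τ j) (τ j') (τ j'')) : CechMC2 f M V) ∈ cechMZ2 f M V := by
  rw [mem_cechMZ2_iff]
  funext j j' j'' j'''
  rw [cechMD2_apply, MSections.res_res, MSections.res_res, MSections.res_res, MSections.res_res]
  exact cechMZ2.cocycle_res f M U hz (τ j) (τ j') (τ j'') (τ j''')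
    (((inf_le_left.trans inf_le_left).trans inf_le_left).trans (hτ j))
    (((inf_le_left.trans inf_le_left).trans inf_le_right).trans (hτ j'))
    ((inf_le_left.trans inf_le_right).trans (hτ j'')) (inf_le_right.trans (hτ j'''))

end Refine

/-! ## `Ȟ⁰ = Γ` on a covered open: gluing `0`-cocycles -/

section H0

variable {ι : Type v} (W : ι → X.Opens) {Y : X.Opens} (hW : ∀ j, W j ≤ Y) (hY : Y ≤ ⨆ j, W j)

include hW hY in
/-- **`Ȟ⁰ = Γ` for a sheaf** (gluing half): a Čech `0`-cochain `b` of `M` on a family `(W_j)`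
covering `Y ⊇ W_j` with `d⁰ b = 0` is the family of restrictions of a section of `M` over `Y`.
[cite: GortzWedhorn2023, Lemma 21.65 (p. 260)] -/
theorem exists_res_eq_of_cechMD0_eq_zero {b : CechMC0 f M W} (hb : cechMD0 f M W b = 0) :
    ∃ t : MSections f M Y, ∀ j, MSections.res f M (hW j) t = b j := by
  refine MSections.exists_res_eq f M W hW hY b fun j j' => ?_
  have h := congrFun (congrFun hb j) j'
  rw [cechMD0_apply, Pi.zero_apply, Pi.zero_apply, sub_eq_zero] at h
  exact h.symm

include hW hY in
/-- **`Ȟ⁰ = Γ` for a sheaf** (locality half): a section of `M` over `Y` is determined by its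
restrictions to a family `(W_j)` covering `Y`. [cite: GortzWedhorn2023, Lemma 21.65 (p. 260)] -/
theorem eq_of_forall_res_eq {s t : MSections f M Y}
    (h : ∀ j, MSections.res f M (hW j) s = MSections.res f M (hW j) t) : s = t :=
  MSections.eq_of_res_eq f M W hW hY h

end H0

/-! ## The transfer theorem -/

section TwoCovers

variable {ι : Type v} {ι' : Type w} (U : ι → X.Opens) (V : ι' → X.Opens)

/-- **Transfer of the vanishing of `Ȟ²` between two families of opens** (the double complex of
two coverings in degree `2`): let `𝒰 = (U_i)`, `𝒱 = (V_j)` be families of opens with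
`U_i ⊆ ⋃_j V_j` and `V_j ⊆ ⋃_i U_i`, and suppose that every `2`-cocycle of `M` on
`(U_i ∩ V_j)_j` is a `2`-coboundary (every `i`), and that every `1`-cocycle of `M` on
`(U_i ∩ U_{i'} ∩ V_j)_j` (all `i, i'`) and on `(U_i ∩ V_j)_i` (every `j`) is a coboundary.  If every
`2`-cocycle of `M` on `𝒰` is a `2`-coboundary, then so is every `2`-cocycle on `𝒱`.  (Degree-`2`
case, in Čech-internal form, of Hartshorne III Lemma 4.4/Thm. 4.5 and Görtz–Wedhorn II Thm. 22.9,
whose printed proofs go through derived functors.)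
[cite: GortzWedhorn2023, Thm. 22.9 (p. 332): degree 2, two-coverings form] -/
theorem cechMZ2_le_cechMB2_of_two_covers (hUV : ∀ i, U i ≤ ⨆ j, V j) (hVU : ∀ j, V j ≤ ⨆ i, U i)
    (h2 : ∀ i, cechMZ2 f M (fun j => U i ⊓ V j) ≤ cechMB2 f M (fun j => U i ⊓ V j))
    (h1 : ∀ i i', cechMZ1 f M (fun j => U i ⊓ U i' ⊓ V j) ≤ cechMB1 f M (fun j => U i ⊓ U i' ⊓ V j))
    (h1' : ∀ j, cechMZ1 f M (fun i => U i ⊓ V j) ≤ cechMB1 f M (fun i => U i ⊓ V j))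
    (hU : cechMZ2 f M U ≤ cechMB2 f M U) : cechMZ2 f M V ≤ cechMB2 f M V := by
  intro z hz
  -- rows of the double complex: the families `F i`, `F₂ i i'`, `F₃ i i' i''`
  let F : ι → ι' → X.Opens := fun i j => U i ⊓ V j
  let F₂ : ι → ι → ι' → X.Opens := fun i i' j => U i ⊓ U i' ⊓ V j
  let F₃ : ι → ι → ι → ι' → X.Opens := fun i i' i'' j => U i ⊓ U i' ⊓ U i'' ⊓ V j
  -- Step 1: `z|_{U_i}` is a `2`-cocycle of `(U_i ∩ V_j)_j`, hence `= d¹ x1 i`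
  have hFV : ∀ i j, F i j ≤ V (id j) := fun i j => inf_le_right
  let zr : ∀ i, CechMC2 f M (F i) := fun i j j' j'' =>
    MSections.res f M (inf_le_inf (inf_le_inf (hFV i j) (hFV i j')) (hFV i j'')) (z j j' j'')
  have hz1 : ∀ i, zr i ∈ cechMZ2 f M (F i) := fun i => refine₂_mem_cechMZ2 f M V (F i) id (hFV i) hz
  choose x1 hx1 using fun i => (mem_cechMB2_iff f M (F i) _).mp (h2 i (hz1 i))
  -- Step 2: `x11 i i' = x1 i'| - x1 i|` on `(U_i ∩ U_i' ∩ V_j)_j` is a `1`-cocycle, hence `= d⁰ x10`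
  have hF₂l : ∀ i i' j, F₂ i i' j ≤ F i j := fun i i' j => inf_le_inf inf_le_left le_rfl
  have hF₂r : ∀ i i' j, F₂ i i' j ≤ F i' j := fun i i' j => inf_le_inf inf_le_right le_rfl
  let x11 : ∀ i i', CechMC1 f M (F₂ i i') := fun i i' =>
    cechMRefineC1 f M (F i') (F₂ i i') id (hF₂r i i') (x1 i') -
      cechMRefineC1 f M (F i) (F₂ i i') id (hF₂l i i') (x1 i)
  have hx11 : ∀ i i', x11 i i' ∈ cechMZ1 f M (F₂ i i') := by
    intro i i'
    rw [mem_cechMZ1_iff, map_sub]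
    funext j j' j''
    rw [Pi.sub_apply, Pi.sub_apply, Pi.sub_apply, Pi.zero_apply, Pi.zero_apply, Pi.zero_apply,
      cechMD1_refineC1_apply, cechMD1_refineC1_apply, hx1, hx1]
    simp only [zr, MSections.res_res]
    exact sub_self _
  choose x10 hx10 using fun i i' => (mem_cechMB1_iff f M (F₂ i i') _).mp (h1 i i' (hx11 i i'))
  -- Step 3: `x20 = Σ ± x10|` on `(U_i ∩ U_i' ∩ U_i'' ∩ V_j)_j` has `d⁰ x20 = 0`, so glues to `y`
  have hF₃a : ∀ i i' i'' j, F₃ i i' i'' j ≤ F₂ i' i'' j := fun i i' i'' j =>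
    inf_le_inf (le_inf (inf_le_left.trans inf_le_right) inf_le_right) le_rfl
  have hF₃b : ∀ i i' i'' j, F₃ i i' i'' j ≤ F₂ i i'' j := fun i i' i'' j =>
    inf_le_inf (le_inf (inf_le_left.trans inf_le_left) inf_le_right) le_rfl
  have hF₃c : ∀ i i' i'' j, F₃ i i' i'' j ≤ F₂ i i' j := fun i i' i'' j =>
    inf_le_inf inf_le_left le_rfl
  let x20 : ∀ i i' i'', CechMC0 f M (F₃ i i' i'') := fun i i' i'' =>
    cechMRefineC0 f M (F₂ i' i'') (F₃ i i' i'') id (hF₃a i i' i'') (x10 i' i'') -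
      cechMRefineC0 f M (F₂ i i'') (F₃ i i' i'') id (hF₃b i i' i'') (x10 i i'') +
        cechMRefineC0 f M (F₂ i i') (F₃ i i' i'') id (hF₃c i i' i'') (x10 i i')
  have hx20 : ∀ i i' i'', cechMD0 f M (F₃ i i' i'') (x20 i i' i'') = 0 := by
    intro i i' i''
    simp only [x20, map_add, map_sub, cechMD0_refineC0, hx10, x11, refineC1_refineC1]
    -- the six double restrictions of the `x1` cancel in pairs
    rw [refineC1_irrel f M (F i'') (F₃ i i' i'') (id ∘ id)
        (fun k => (hF₃b i i' i'' k).trans (hF₂r i i'' (id k)))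
        (fun k => (hF₃a i i' i'' k).trans (hF₂r i' i'' (id k))),
      refineC1_irrel f M (F i) (F₃ i i' i'') (id ∘ id)
        (fun k => (hF₃c i i' i'' k).trans (hF₂l i i' (id k)))
        (fun k => (hF₃b i i' i'' k).trans (hF₂l i i'' (id k))),
      refineC1_irrel f M (F i') (F₃ i i' i'') (id ∘ id)
        (fun k => (hF₃c i i' i'' k).trans (hF₂r i i' (id k)))
        (fun k => (hF₃a i i' i'' k).trans (hF₂l i' i'' (id k)))]
    abel
  have hcov₃ : ∀ i i' i'', U i ⊓ U i' ⊓ U i'' ≤ ⨆ j, F₃ i i' i'' j := fun i i' i'' => by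
    change _ ≤ ⨆ j, U i ⊓ U i' ⊓ U i'' ⊓ V j
    rw [← inf_iSup_eq]
    exact le_inf le_rfl ((inf_le_left.trans inf_le_left).trans (hUV i))
  choose y hy using fun i i' i'' => exists_res_eq_of_cechMD0_eq_zero f M (F₃ i i' i'')
    (Y := U i ⊓ U i' ⊓ U i'') (fun j => inf_le_left) (hcov₃ i i' i'') (hx20 i i' i'')
  -- Step 4: `y` is a `2`-cocycle of `𝒰` (check on the `V_j`, where everything cancels)
  have hyZ : y ∈ cechMZ2 f M U := by
    rw [mem_cechMZ2_iff]
    funext i₀ i₁ i₂ i₃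
    rw [Pi.zero_apply, Pi.zero_apply, Pi.zero_apply, Pi.zero_apply]
    have hcov₄ : U i₀ ⊓ U i₁ ⊓ U i₂ ⊓ U i₃ ≤ ⨆ j, U i₀ ⊓ U i₁ ⊓ U i₂ ⊓ U i₃ ⊓ V j := by
      rw [← inf_iSup_eq]
      exact le_inf le_rfl (((inf_le_left.trans inf_le_left).trans inf_le_left).trans (hUV i₀))
    apply eq_of_forall_res_eq f M (fun j => U i₀ ⊓ U i₁ ⊓ U i₂ ⊓ U i₃ ⊓ V j)
      (fun j => inf_le_left) hcov₄
    intro j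
    have hG0 : U i₀ ⊓ U i₁ ⊓ U i₂ ⊓ U i₃ ⊓ V j ≤ U i₀ :=
      ((inf_le_left.trans inf_le_left).trans inf_le_left).trans inf_le_left
    have hG1 : U i₀ ⊓ U i₁ ⊓ U i₂ ⊓ U i₃ ⊓ V j ≤ U i₁ :=
      ((inf_le_left.trans inf_le_left).trans inf_le_left).trans inf_le_right
    have hG2 : U i₀ ⊓ U i₁ ⊓ U i₂ ⊓ U i₃ ⊓ V j ≤ U i₂ :=
      (inf_le_left.trans inf_le_left).trans inf_le_right
    have hG3 : U i₀ ⊓ U i₁ ⊓ U i₂ ⊓ U i₃ ⊓ V j ≤ U i₃ := inf_le_left.trans inf_le_right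
    have hGj : U i₀ ⊓ U i₁ ⊓ U i₂ ⊓ U i₃ ⊓ V j ≤ V j := inf_le_right
    have e1 := congrArg (MSections.res f M
      (le_inf (le_inf (le_inf hG1 hG2) hG3) hGj : _ ≤ F₃ i₁ i₂ i₃ j)) (hy i₁ i₂ i₃ j)
    have e2 := congrArg (MSections.res f M
      (le_inf (le_inf (le_inf hG0 hG2) hG3) hGj : _ ≤ F₃ i₀ i₂ i₃ j)) (hy i₀ i₂ i₃ j)
    have e3 := congrArg (MSections.res f M
      (le_inf (le_inf (le_inf hG0 hG1) hG3) hGj : _ ≤ F₃ i₀ i₁ i₃ j)) (hy i₀ i₁ i₃ j)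
    have e4 := congrArg (MSections.res f M
      (le_inf (le_inf (le_inf hG0 hG1) hG2) hGj : _ ≤ F₃ i₀ i₁ i₂ j)) (hy i₀ i₁ i₂ j)
    rw [MSections.res_res] at e1 e2 e3 e4
    rw [map_zero, cechMD2_apply, map_sub, map_add, map_sub, MSections.res_res, MSections.res_res,
      MSections.res_res, MSections.res_res]
    erw [e1, e2, e3, e4]
    simp only [x20, Pi.add_apply, Pi.sub_apply, map_add, map_sub, cechMRefineC0_apply,
      MSections.res_res]
    have key : ∀ (A23 A13 A12 A03 A02 A01 : MSections f M (U i₀ ⊓ U i₁ ⊓ U i₂ ⊓ U i₃ ⊓ V j)),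
        (A23 - A13 + A12) - (A23 - A03 + A02) + (A13 - A03 + A01) - (A12 - A02 + A01) = 0 := by
      intro A23 A13 A12 A03 A02 A01; abel
    exact key _ _ _ _ _ _
  -- Step 5: by hypothesis `y = d¹ w`
  obtain ⟨w, hw⟩ := (mem_cechMB2_iff f M U y).mp (hU hyZ)
  -- Step 6: on each column `(U_i ∩ V_j)_i`, `x10(·,·,j) - w|` is a `1`-cocycle, hence `= d⁰ (u j)`
  have hPa : ∀ j i i', (U i ⊓ V j) ⊓ (U i' ⊓ V j) ≤ F₂ i i' j := fun j i i' =>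
    le_inf (le_inf (inf_le_left.trans inf_le_left) (inf_le_right.trans inf_le_left))
      (inf_le_left.trans inf_le_right)
  have hPb : ∀ j i i', (U i ⊓ V j) ⊓ (U i' ⊓ V j) ≤ U i ⊓ U i' := fun j i i' =>
    inf_le_inf inf_le_left inf_le_left
  let v : ∀ j, CechMC1 f M (fun i => U i ⊓ V j) := fun j i i' =>
    MSections.res f M (hPa j i i') (x10 i i' j) - MSections.res f M (hPb j i i') (w i i')
  have hv : ∀ j, v j ∈ cechMZ1 f M (fun i => U i ⊓ V j) := by
    intro j
    rw [mem_cechMZ1_iff]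
    funext i i' i''
    rw [Pi.zero_apply, Pi.zero_apply, Pi.zero_apply, cechMD1_apply]
    simp only [v, map_sub, MSections.res_res]
    have hPi : (U i ⊓ V j) ⊓ (U i' ⊓ V j) ⊓ (U i'' ⊓ V j) ≤ U i :=
      (inf_le_left.trans inf_le_left).trans inf_le_left
    have hPi' : (U i ⊓ V j) ⊓ (U i' ⊓ V j) ⊓ (U i'' ⊓ V j) ≤ U i' :=
      (inf_le_left.trans inf_le_right).trans inf_le_left
    have hPi'' : (U i ⊓ V j) ⊓ (U i' ⊓ V j) ⊓ (U i'' ⊓ V j) ≤ U i'' :=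
      inf_le_right.trans inf_le_left
    have hPj : (U i ⊓ V j) ⊓ (U i' ⊓ V j) ⊓ (U i'' ⊓ V j) ≤ V j := inf_le_right.trans inf_le_right
    have e1 := congrArg (MSections.res f M
      (le_inf (le_inf (le_inf hPi hPi') hPi'') hPj : _ ≤ F₃ i i' i'' j)) (hy i i' i'' j)
    simp only [x20, Pi.add_apply, Pi.sub_apply, map_add, map_sub, cechMRefineC0_apply,
      MSections.res_res] at e1
    have e2 := congrArg (MSections.res f M
      (le_inf (le_inf hPi hPi') hPi'' : _ ≤ U i ⊓ U i' ⊓ U i''))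
      (congrFun (congrFun (congrFun hw i) i') i'')
    rw [cechMD1_apply, map_add, map_sub, MSections.res_res, MSections.res_res,
      MSections.res_res] at e2
    have key : ∀ (X1 X2 X3 W1 W2 W3 Y : MSections f M ((U i ⊓ V j) ⊓ (U i' ⊓ V j) ⊓ (U i'' ⊓ V j))),
        Y = X1 - X2 + X3 → W1 - W2 + W3 = Y → X1 - W1 - (X2 - W2) + (X3 - W3) = 0 := by
      intro X1 X2 X3 W1 W2 W3 Y h1 h2
      have : X1 - W1 - (X2 - W2) + (X3 - W3) = (X1 - X2 + X3) - (W1 - W2 + W3) := by abel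
      rw [this, ← h1, h2, sub_self]
    exact key _ _ _ _ _ _ _ e1 e2
  choose u hu using fun j => (mem_cechMB1_iff f M (fun i => U i ⊓ V j) _).mp (h1' j (hv j))
  -- `hu' j i i'`: `u j i'| - u j i| = x10 i i' j| - w i i'|` on `(U_i ∩ V_j) ∩ (U_i' ∩ V_j)`
  have hu' : ∀ j i i', MSections.res f M inf_le_right (u j i') - MSections.res f M inf_le_left (u j i)
      = MSections.res f M (hPa j i i') (x10 i i' j) - MSections.res f M (hPb j i i') (w i i') := by
    intro j i i'
    have := congrFun (congrFun (hu j) i) i'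
    rw [cechMD0_apply] at this
    exact this
  -- Step 7: the sections `x1 i j j' - (u j' i| - u j i|)` glue over `i` to `t j j'`
  let H : ι' → ι' → ι → X.Opens := fun j j' i => (U i ⊓ V j) ⊓ (U i ⊓ V j')
  have hH : ∀ j j' i, H j j' i ≤ V j ⊓ V j' := fun j j' i => inf_le_inf inf_le_right inf_le_right
  have hcovH : ∀ j j', V j ⊓ V j' ≤ ⨆ i, H j j' i := by
    intro j j'
    calc V j ⊓ V j' ≤ ⨆ i, U i ⊓ (V j ⊓ V j') := by
          rw [← iSup_inf_eq]; exact le_inf (inf_le_left.trans (hVU j)) le_rfl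
      _ ≤ ⨆ i, H j j' i := iSup_mono fun i =>
          le_inf (le_inf inf_le_left (inf_le_right.trans inf_le_left))
            (le_inf inf_le_left (inf_le_right.trans inf_le_right))
  let sH : ∀ j j' i, MSections f M (H j j' i) := fun j j' i =>
    x1 i j j' - (MSections.res f M inf_le_right (u j' i) - MSections.res f M inf_le_left (u j i))
  have hglue : ∀ j j' i i',
      MSections.res f M (inf_le_left : H j j' i ⊓ H j j' i' ≤ _) (sH j j' i) =
        MSections.res f M (inf_le_right : H j j' i ⊓ H j j' i' ≤ _) (sH j j' i') := by
    intro j j' i i'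
    simp only [sH, map_sub, MSections.res_res]
    have hQi : H j j' i ⊓ H j j' i' ≤ U i := inf_le_left.trans (inf_le_left.trans inf_le_left)
    have hQi' : H j j' i ⊓ H j j' i' ≤ U i' := inf_le_right.trans (inf_le_left.trans inf_le_left)
    have hQj : H j j' i ⊓ H j j' i' ≤ V j := inf_le_left.trans (inf_le_left.trans inf_le_right)
    have hQj' : H j j' i ⊓ H j j' i' ≤ V j' := inf_le_left.trans (inf_le_right.trans inf_le_right)
    -- (a) `x10 i i' j'| - x10 i i' j| = x1 i' j j'| - x1 i j j'|` (from `d⁰ x10 = x11`)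
    have ea := congrFun (congrFun (hx10 i i') j) j'
    rw [cechMD0_apply] at ea
    have ea' := congrArg (MSections.res f M (le_inf (le_inf (le_inf hQi hQi') hQj)
      (le_inf (le_inf hQi hQi') hQj') : _ ≤ F₂ i i' j ⊓ F₂ i i' j')) ea
    simp only [x11, Pi.sub_apply, cechMRefineC1_apply, map_sub, MSections.res_res] at ea'
    have eb := congrArg (MSections.res f M
      (le_inf (le_inf hQi hQj) (le_inf hQi' hQj) : _ ≤ (U i ⊓ V j) ⊓ (U i' ⊓ V j))) (hu' j i i')
    have ec := congrArg (MSections.res f M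
      (le_inf (le_inf hQi hQj') (le_inf hQi' hQj') : _ ≤ (U i ⊓ V j') ⊓ (U i' ⊓ V j')))
      (hu' j' i i')
    simp only [map_sub, MSections.res_res] at eb ec
    have key : ∀ (X1i X1i' A Aj' Uji Uji' Uj'i Uj'i' W : MSections f M (H j j' i ⊓ H j j' i')),
        Aj' - A = X1i' - X1i → Uji' - Uji = A - W → Uj'i' - Uj'i = Aj' - W →
          X1i - (Uj'i - Uji) = X1i' - (Uj'i' - Uji') := by
      intro X1i X1i' A Aj' Uji Uji' Uj'i Uj'i' W h1 h2 h3
      rw [← sub_eq_zero]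
      have : X1i - (Uj'i - Uji) - (X1i' - (Uj'i' - Uji')) =
          -(X1i' - X1i) + (Uj'i' - Uj'i) - (Uji' - Uji) := by abel
      rw [this, ← h1, h2, h3]
      abel
    exact key _ _ _ _ _ _ _ _ _ ea' eb ec
  choose t ht using fun j j' => MSections.exists_res_eq f M (H j j') (hH j j') (hcovH j j')
    (sH j j') (hglue j j')
  -- Step 8: `d¹ t = z` (check on the `U_i`)
  refine (mem_cechMB2_iff f M V z).mpr ⟨t, ?_⟩
  funext j j' j''
  let K : ι → X.Opens := fun i => (U i ⊓ V j) ⊓ (U i ⊓ V j') ⊓ (U i ⊓ V j'')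
  have hK : ∀ i, K i ≤ V j ⊓ V j' ⊓ V j'' := fun i =>
    inf_le_inf (inf_le_inf inf_le_right inf_le_right) inf_le_right
  have hcovK : V j ⊓ V j' ⊓ V j'' ≤ ⨆ i, K i := by
    calc V j ⊓ V j' ⊓ V j'' ≤ ⨆ i, U i ⊓ (V j ⊓ V j' ⊓ V j'') := by
          rw [← iSup_inf_eq]
          exact le_inf ((inf_le_left.trans inf_le_left).trans (hVU j)) le_rfl
      _ ≤ ⨆ i, K i := iSup_mono fun i =>
          le_inf (le_inf (le_inf inf_le_left (inf_le_right.trans (inf_le_left.trans inf_le_left)))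
            (le_inf inf_le_left (inf_le_right.trans (inf_le_left.trans inf_le_right))))
            (le_inf inf_le_left (inf_le_right.trans inf_le_right))
  apply eq_of_forall_res_eq f M K hK hcovK
  intro i
  have hKa : K i ≤ H j' j'' i := le_inf (inf_le_left.trans inf_le_right) inf_le_right
  have hKb : K i ≤ H j j'' i := le_inf (inf_le_left.trans inf_le_left) inf_le_right
  have hKc : K i ≤ H j j' i := inf_le_left
  have e1 := congrArg (MSections.res f M hKa) (ht j' j'' i)
  have e2 := congrArg (MSections.res f M hKb) (ht j j'' i)
  have e3 := congrArg (MSections.res f M hKc) (ht j j' i)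
  rw [MSections.res_res] at e1 e2 e3
  rw [cechMD1_apply, map_add, map_sub, MSections.res_res, MSections.res_res, MSections.res_res]
  erw [e1, e2, e3]
  simp only [sH, map_sub, MSections.res_res]
  have ez := congrFun (congrFun (congrFun (hx1 i) j) j') j''
  rw [cechMD1_apply] at ez
  have key : ∀ (X1 X2 X3 U0 U1 U2 Z : MSections f M (K i)),
      X1 - X2 + X3 = Z → (X1 - (U2 - U1)) - (X2 - (U2 - U0)) + (X3 - (U1 - U0)) = Z := by
    intro X1 X2 X3 U0 U1 U2 Z h
    rw [← h]; abel
  exact key _ _ _ _ _ _ _ ez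

end TwoCovers

end Literature.AlgebraicGeometry.Morphisms

end
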